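import Summits.RiemannHypothesis.RiemannHypothesis.Theorems.JensenPolynomialsFarGumbelCloser

/-!
# Route `JensenPolynomials`, FAR crux `XiWindowZeroFreeRelFar` (B1-rel far) — S3 WANTED item (L2): curvature on the
saddle disc (RH-FREE; cell rh-jensen, HUMAN RULING D-0040)

Item `stmt-RiemannHypothesis-19465`, stub S3 `stub_laplaceFar`, WANTED list v3 (HOME `eng-4/S3/S3-WANTED.lean`), item (L2)
`wanted_curvature`: for every `u` of the saddle disc `‖u − (υ + ξ₀/4)‖ ≤ 1/(10υ²)` (`ξ₀ = farXi0 w (1/υ)`, `w = farW(a/υ²)`),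
`Re Ψ″(u) ≤ −8Λ` and `‖Ψ″(u)‖ ≤ 32Λ` (`Ψ″ = farPsi2 M a`, `Λ = farLam υ = πe^{4υ}`).

Proof (crude triangle inequalities): with `L = Log w`, `θ = L·ε(1/4 − w/2)`, `d = u − u₀`, one has EXACTLY
`π e^{4u} = Λ · w · e^{θ + 4d}` (because `4(u − υ) = ξ₀ + 4d = L + θ + 4d` and `e^{L} = w`), so
`Ψ″(u) = −16Λ·w·e^{δ'} − 1/u² + C`, `δ' = θ + 4d`, `C = (2M−1)(a−u²)/(u²+a)²`; and on `‖z̃‖ ≤ 9/25`: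
`Re w ≥ 25/34`, `‖w‖ ≤ 25/16`, `‖L‖ ≤ 37/80`, `‖θ‖ ≤ 51/1000`, `‖δ'‖ ≤ 11/200`, `‖e^{δ'} − 1‖ ≤ 59/1000`,
`Re(w e^{δ'}) ≥ 0.644`, `‖w e^{δ'}‖ ≤ 1.66`, `‖1/u²‖ ≤ 1/50`, `‖C‖ ≤ 4Λυ · 1.39υ² / (0.58υ²)² ≤ 2Λ`.
WHAT THIS IS NOT: elementary bookkeeping about an explicit phase function; nothing here bears on the zeros of `ζ` or RH.
-/

noncomputable section
-- D-0017: `Summit.RiemannHypothesis.RiemannHypothesis.…` duplicates the namespace BY DESIGN (single-problem summit).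
set_option linter.dupNamespace false

namespace Summit.RiemannHypothesis.RiemannHypothesis.Theorems.JensenPolynomials.FarGumbel

open Complex Metric
open scoped Real

/-- Möbius geometry: for `‖z‖ ≤ r < 1`, `Re (1+z)⁻¹ ≥ 1/(1+r)`. -/
theorem re_inv_one_add_ge {z : ℂ} {r : ℝ} (hz : ‖z‖ ≤ r) (hr : r < 1) :
    1 / (1 + r) ≤ ((1 + z)⁻¹).re := by
  have hρ0 : 0 ≤ ‖z‖ := norm_nonneg z
  have hzre : |z.re| ≤ ‖z‖ := Complex.abs_re_le_norm z
  obtain ⟨hzre1, hzre2⟩ := abs_le.mp hzre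
  have hns : Complex.normSq (1 + z) = 1 + 2 * z.re + ‖z‖ ^ 2 := by
    rw [Complex.sq_norm, Complex.normSq_apply, Complex.normSq_apply]; simp; ring
  have hpos : 0 < 1 + 2 * z.re + ‖z‖ ^ 2 := by nlinarith
  rw [Complex.inv_re, hns]
  have hre1 : (1 + z).re = 1 + z.re := by simp
  rw [hre1, div_le_div_iff₀ (by linarith) hpos]
  have hρr : ‖z‖ ^ 2 ≤ r * ‖z‖ := by rw [sq]; exact mul_le_mul_of_nonneg_right hz hρ0
  nlinarith [mul_nonneg (sub_nonneg.mpr (le_trans hzre2 hz)) (sub_pos.mpr hr).le, hρr,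
    mul_le_mul_of_nonneg_left hz (show (0:ℝ) ≤ r by linarith)]

/-- For `‖z‖ ≤ r < 1`, `‖(1+z)⁻¹‖ ≤ 1/(1−r)`. -/
theorem norm_inv_one_add_le {z : ℂ} {r : ℝ} (hz : ‖z‖ ≤ r) (hr : r < 1) :
    ‖(1 + z)⁻¹‖ ≤ 1 / (1 - r) := by
  have h1 : 1 - r ≤ ‖1 + z‖ := by
    have h3 := norm_add_le (1 + z) (-z)
    simp only [add_neg_cancel_right, norm_neg] at h3
    have : ‖(1 : ℂ)‖ = 1 := by simp
    linarith
  rw [norm_inv, inv_eq_one_div]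
  exact one_div_le_one_div_of_le (by linarith) h1

/-- `‖Log(farW z̃)‖ ≤ 37/80` for `‖z̃‖ ≤ 9/25` (`Log w = −Log(1+z̃)` as `Re(1+z̃) > 0`; `‖Log(1+z̃)‖ ≤ ρ + ρ²/(2(1−ρ))`). -/
theorem norm_log_farW_le {z : ℂ} (hz : ‖z‖ ≤ 9 / 25) : ‖Complex.log (farW z)‖ ≤ 37 / 80 := by
  have hz1 : ‖z‖ < 1 := by linarith
  have hre : 0 < (1 + z).re := by
    have := (abs_le.mp (Complex.abs_re_le_norm z)).1
    simp only [Complex.add_re, Complex.one_re]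
    linarith
  have harg : (1 + z).arg ≠ π := by
    intro h
    rw [Complex.arg_eq_pi_iff] at h
    linarith [h.1]
  rw [farW, Complex.log_inv _ harg, norm_neg]
  refine (Complex.norm_log_one_add_le hz1).trans ?_
  have h0 := norm_nonneg z
  have h1 : (1 - ‖z‖)⁻¹ ≤ (16 / 25)⁻¹ := by
    apply inv_anti₀ (by norm_num)
    linarith
  have h2 : ‖z‖ ^ 2 ≤ (9 / 25) ^ 2 := pow_le_pow_left₀ h0 hz 2
  have h3 : 0 ≤ (1 - ‖z‖)⁻¹ := inv_nonneg.mpr (by linarith)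
  have h4 : ‖z‖ ^ 2 * (1 - ‖z‖)⁻¹ ≤ (9 / 25) ^ 2 * (16 / 25)⁻¹ :=
    mul_le_mul h2 h1 h3 (by norm_num)
  linarith

/-- **(L2) of the S3 WANTED list v3: curvature on the saddle disc.** For the far mode `υ` (`4πe^{4υ}υ = 2M + 9υ`,
`υ ≥ 189/20`), `‖a‖ ≤ (9/25)υ²` and every `u` with `‖u − (υ + ξ₀/4)‖ ≤ 1/(10υ²)`:
`Re Ψ″(u) ≤ −8Λ` and `‖Ψ″(u)‖ ≤ 32Λ`. -/
theorem wanted_curvature (M : ℕ) (hM : 2 * 10 ^ 18 ≤ M) (υ : ℝ)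
    (hυ : (189 / 20 : ℝ) ≤ υ ∧ 4 * Real.pi * Real.exp (4 * υ) * υ = 2 * (M : ℝ) + 9 * υ)
    (a : ℂ) (ha : ‖a‖ ≤ (9 / 25 : ℝ) * υ ^ 2) (u : ℂ)
    (hu : ‖u - ((υ : ℂ) + farXi0 (farW (a / (υ : ℂ) ^ 2)) (1 / υ) / 4)‖ ≤ 1 / (10 * υ ^ 2)) :
    (farPsi2 M a u).re ≤ -8 * farLam υ ∧ ‖farPsi2 M a u‖ ≤ 32 * farLam υ := by
  have _hM := hM
  obtain ⟨hυ0, hmode⟩ := hυ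
  have hυpos : 0 < υ := by linarith
  have hυ2 : (89 : ℝ) ≤ υ ^ 2 := by nlinarith
  set Λ := farLam υ with hΛdef
  have hΛ9 : 9000000 ≤ Λ := farLam_ge_nine_million υ hυ0
  have hΛpos : 0 < Λ := by linarith
  -- z̃ and w
  set z := a / (υ : ℂ) ^ 2 with hzdef
  have hnυ2 : ‖(υ : ℂ) ^ 2‖ = υ ^ 2 := by
    rw [norm_pow, Complex.norm_real, Real.norm_eq_abs, abs_of_pos hυpos]
  have hz : ‖z‖ ≤ 9 / 25 := by
    rw [hzdef, norm_div, hnυ2, div_le_iff₀ (by positivity)]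
    exact ha
  set w := farW z with hwdef
  have hw' : w = (1 + z)⁻¹ := rfl
  have hwre : 25 / 34 ≤ w.re := by
    have := re_inv_one_add_ge hz (by norm_num : (9 / 25 : ℝ) < 1)
    rw [hw']
    norm_num at this ⊢
    exact this
  have hwn : ‖w‖ ≤ 25 / 16 := by
    have := norm_inv_one_add_le hz (by norm_num : (9 / 25 : ℝ) < 1)
    rw [hw']
    norm_num at this ⊢
    exact this
  have hw0 : w ≠ 0 := by
    intro h
    rw [h] at hwre
    simp at hwre
    linarith
  set L := Complex.log w with hLdef
  have hL : ‖L‖ ≤ 37 / 80 := norm_log_farW_le hz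
  -- θ, d, δ'
  set θ : ℂ := L * ((((1 / υ : ℝ)) : ℂ) * (1 / 4 - w / 2)) with hθdef
  have hξ0 : farXi0 w (1 / υ) = L + θ := by
    rw [farXi0, hθdef, hLdef]
    ring
  have hε : (1 / υ : ℝ) ≤ 20 / 189 := by
    have := one_div_le_one_div_of_le (by norm_num : (0 : ℝ) < 189 / 20) hυ0
    linarith [show (1 : ℝ) / (189 / 20) = 20 / 189 by norm_num]
  have hθ : ‖θ‖ ≤ 51 / 1000 := by
    rw [hθdef, norm_mul, norm_mul, Complex.norm_real, Real.norm_eq_abs, abs_of_pos (by positivity)]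
    have h14 : ‖(1 / 4 - w / 2 : ℂ)‖ ≤ 1 / 4 + 25 / 32 := by
      calc ‖(1 / 4 - w / 2 : ℂ)‖ ≤ ‖(1 / 4 : ℂ)‖ + ‖w / 2‖ := norm_sub_le _ _
        _ ≤ 1 / 4 + 25 / 32 := by
          rw [norm_div, norm_div, norm_one]
          have e4 : ‖(4 : ℂ)‖ = 4 := by simp
          have e2 : ‖(2 : ℂ)‖ = 2 := by simp
          rw [e4, e2]
          linarith
    calc ‖L‖ * (1 / υ * ‖(1 / 4 - w / 2 : ℂ)‖) ≤ 37 / 80 * (20 / 189 * (1 / 4 + 25 / 32)) := by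
          gcongr
      _ ≤ 51 / 1000 := by norm_num
  set u₀ : ℂ := (υ : ℂ) + farXi0 w (1 / υ) / 4 with hu0def
  set d : ℂ := u - u₀ with hddef
  have hd : ‖d‖ ≤ 1 / 890 := by
    have : 1 / (10 * υ ^ 2) ≤ (1 : ℝ) / 890 := one_div_le_one_div_of_le (by norm_num) (by linarith only [hυ2])
    exact hu.trans this
  set δ' : ℂ := θ + 4 * d with hδdef
  have hδ : ‖δ'‖ ≤ 56 / 1000 := by
    have e4 : ‖(4 : ℂ)‖ = 4 := by simp
    have e4d : ‖(4 : ℂ) * d‖ = 4 * ‖d‖ := by rw [norm_mul, e4]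
    calc ‖δ'‖ ≤ ‖θ‖ + ‖4 * d‖ := norm_add_le _ _
      _ = ‖θ‖ + 4 * ‖d‖ := by rw [e4d]
      _ ≤ 51 / 1000 + 4 * (1 / 890) := by gcongr
      _ ≤ 56 / 1000 := by norm_num
  have hE1 : ‖Complex.exp δ' - 1‖ ≤ 3 / 50 := by
    have h1 := Complex.norm_exp_sub_one_sub_id_le (x := δ') (by linarith)
    have e : Complex.exp δ' - 1 = (Complex.exp δ' - 1 - δ') + δ' := by ring
    rw [e]
    calc ‖(Complex.exp δ' - 1 - δ') + δ'‖ ≤ ‖Complex.exp δ' - 1 - δ'‖ + ‖δ'‖ := norm_add_le _ _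
      _ ≤ ‖δ'‖ ^ 2 + ‖δ'‖ := by gcongr
      _ ≤ (56 / 1000) ^ 2 + 56 / 1000 := by gcongr
      _ ≤ 3 / 50 := by norm_num
  -- KEY identity `π e^{4u} = Λ w e^{δ'}`
  have hkey : (π : ℂ) * Complex.exp (4 * u) = (Λ : ℂ) * w * Complex.exp δ' := by
    have h4u : 4 * u = ((4 * υ : ℝ) : ℂ) + L + δ' := by
      rw [hδdef, hddef, hu0def, hξ0]
      push_cast
      ring
    rw [h4u, Complex.exp_add, Complex.exp_add, hLdef, Complex.exp_log hw0]
    simp only [hΛdef, farLam]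
    push_cast
    ring
  -- decomposition of `farPsi2`
  set C : ℂ := (2 * (M : ℂ) - 1) * (a - u ^ 2) / (u ^ 2 + a) ^ 2 with hCdef
  have hΨ : farPsi2 M a u = ((-16 * Λ : ℝ) : ℂ) * (w * Complex.exp δ') - 1 / u ^ 2 + C := by
    rw [farPsi2, hCdef]
    have : -16 * (π : ℂ) * Complex.exp (4 * u) = ((-16 * Λ : ℝ) : ℂ) * (w * Complex.exp δ') := by
      rw [mul_assoc, hkey]
      push_cast
      ring
    rw [this]
  -- `‖u − υ‖ ≤ 0.13`
  have huυ : ‖u - υ‖ ≤ 13 / 100 := by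
    have e4 : ‖(4 : ℂ)‖ = 4 := by simp
    have e : u - υ = (L + θ) / 4 + d := by
      rw [hddef, hu0def, hξ0]
      ring
    rw [e]
    calc ‖(L + θ) / 4 + d‖ ≤ ‖(L + θ) / 4‖ + ‖d‖ := norm_add_le _ _
      _ = ‖L + θ‖ / 4 + ‖d‖ := by rw [norm_div, e4]
      _ ≤ (‖L‖ + ‖θ‖) / 4 + ‖d‖ := by gcongr; exact norm_add_le _ _
      _ ≤ (37 / 80 + 51 / 1000) / 4 + 1 / 890 := by gcongr
      _ ≤ 13 / 100 := by norm_num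
  have hnυ : ‖(υ : ℂ)‖ = υ := by rw [Complex.norm_real, Real.norm_eq_abs, abs_of_pos hυpos]
  have hun_lo : υ - 13 / 100 ≤ ‖u‖ := by
    have := norm_sub_norm_le (υ : ℂ) u
    rw [norm_sub_rev, hnυ] at this
    linarith
  have hun_hi : ‖u‖ ≤ υ + 13 / 100 := by
    have := norm_add_le (u - υ) (υ : ℂ)
    simp only [sub_add_cancel] at this
    rw [hnυ] at this
    linarith
  have hu9 : 9 ≤ ‖u‖ := by linarith
  -- `‖1/u²‖ ≤ 1/81`
  have hB : ‖(1 : ℂ) / u ^ 2‖ ≤ 1 / 81 := by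
    rw [norm_div, norm_one, norm_pow]
    exact one_div_le_one_div_of_le (by norm_num) (by nlinarith only [hu9])
  -- `2M − 1 = 4Λυ − 9υ − 1`
  have h2M : (2 * (M : ℂ) - 1) = ((4 * Λ * υ - 9 * υ - 1 : ℝ) : ℂ) := by
    have e1 : (2 * (M : ℝ) - 1) = 4 * Λ * υ - 9 * υ - 1 := by
      simp only [hΛdef, farLam]
      linarith
    have e : (2 * (M : ℂ) - 1) = ((2 * (M : ℝ) - 1 : ℝ) : ℂ) := by push_cast; ring
    rw [e, e1]
  have hprod : 189 / 20 * (4 * 9000000 - 9) ≤ υ * (4 * Λ - 9) :=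
    mul_le_mul hυ0 (by linarith only [hΛ9]) (by norm_num) hυpos.le
  have h2Mn : ‖(2 * (M : ℂ) - 1)‖ ≤ 4 * Λ * υ := by
    rw [h2M, Complex.norm_real, Real.norm_eq_abs, abs_of_pos (by linarith only [hprod])]
    linarith only [hυpos]
  -- `‖a − u²‖ ≤ 1.39υ²`, `‖u² + a‖ ≥ 0.58υ²`
  have hnum : ‖a - u ^ 2‖ ≤ 139 / 100 * υ ^ 2 := by
    have h1 : ‖u‖ ^ 2 ≤ (υ + 13 / 100) ^ 2 := pow_le_pow_left₀ (norm_nonneg u) hun_hi 2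
    calc ‖a - u ^ 2‖ ≤ ‖a‖ + ‖u ^ 2‖ := norm_sub_le _ _
      _ ≤ 9 / 25 * υ ^ 2 + (υ + 13 / 100) ^ 2 := by rw [norm_pow]; gcongr
      _ ≤ 139 / 100 * υ ^ 2 := by
          have h3 : 189 / 20 * (3 / 100 * υ) ≤ υ * (3 / 100 * υ) :=
            mul_le_mul_of_nonneg_right hυ0 (by positivity)
          nlinarith only [h3, hυ0]
  have hden : 58 / 100 * υ ^ 2 ≤ ‖u ^ 2 + a‖ := by
    have h1 := norm_sub_norm_le (u ^ 2) (-a)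
    rw [norm_neg, sub_neg_eq_add, norm_pow] at h1
    have h2 : (υ - 13 / 100) ^ 2 ≤ ‖u‖ ^ 2 := pow_le_pow_left₀ (by linarith) hun_lo 2
    have e : (υ - 13 / 100) ^ 2 = υ ^ 2 - 26 / 100 * υ + 169 / 10000 := by ring
    rw [e] at h2
    have h3 : 26 / 100 * υ ≤ 6 / 100 * υ ^ 2 := by
      have := mul_le_mul_of_nonneg_left hυ0 (show (0 : ℝ) ≤ 6 / 100 * υ by positivity)
      nlinarith only [this, hυpos]
    linarith only [h1, h2, h3, ha]
  -- `‖C‖ ≤ 2Λ`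
  have hC : ‖C‖ ≤ 2 * Λ := by
    have hden0 : 0 < ‖u ^ 2 + a‖ := lt_of_lt_of_le (by positivity) hden
    rw [hCdef, norm_div, norm_mul, norm_pow, div_le_iff₀ (by positivity)]
    have hcoef : (556 : ℝ) / 100 ≤ 6728 / 10000 * υ := by linarith
    have hc2 := mul_le_mul_of_nonneg_left hcoef (show 0 ≤ Λ * υ ^ 3 by positivity)
    calc ‖(2 * (M : ℂ) - 1)‖ * ‖a - u ^ 2‖ ≤ (4 * Λ * υ) * (139 / 100 * υ ^ 2) := by gcongr
      _ = Λ * υ ^ 3 * (556 / 100) := by ring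
      _ ≤ Λ * υ ^ 3 * (6728 / 10000 * υ) := hc2
      _ = 2 * Λ * (58 / 100 * υ ^ 2) ^ 2 := by ring
      _ ≤ 2 * Λ * ‖u ^ 2 + a‖ ^ 2 := by gcongr
  -- main-term bounds
  have hwE_re : 641 / 1000 ≤ (w * Complex.exp δ').re := by
    have e : w * Complex.exp δ' = w + w * (Complex.exp δ' - 1) := by ring
    rw [e, Complex.add_re]
    have h1 := (abs_le.mp (Complex.abs_re_le_norm (w * (Complex.exp δ' - 1)))).1
    have h2 : ‖w * (Complex.exp δ' - 1)‖ ≤ 25 / 16 * (3 / 50) := by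
      rw [norm_mul]
      exact mul_le_mul hwn hE1 (norm_nonneg _) (by norm_num)
    linarith
  have hwE_n : ‖w * Complex.exp δ'‖ ≤ 25 / 16 * (53 / 50) := by
    rw [norm_mul]
    have : ‖Complex.exp δ'‖ ≤ 53 / 50 := by
      have e : Complex.exp δ' = (Complex.exp δ' - 1) + 1 := by ring
      rw [e]
      calc ‖(Complex.exp δ' - 1) + 1‖ ≤ ‖Complex.exp δ' - 1‖ + ‖(1 : ℂ)‖ := norm_add_le _ _
        _ ≤ 3 / 50 + 1 := by rw [norm_one]; linarith
        _ = 53 / 50 := by norm_num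
    exact mul_le_mul hwn this (norm_nonneg _) (by norm_num)
  have hmain_re : (((-16 * Λ : ℝ) : ℂ) * (w * Complex.exp δ')).re ≤ -16 * Λ * (641 / 1000) := by
    rw [Complex.re_ofReal_mul]
    exact mul_le_mul_of_nonpos_left hwE_re (by linarith only [hΛpos])
  have hmain_n : ‖((-16 * Λ : ℝ) : ℂ) * (w * Complex.exp δ')‖ ≤ 16 * Λ * (25 / 16 * (53 / 50)) := by
    rw [norm_mul, Complex.norm_real, Real.norm_eq_abs, abs_of_neg (by linarith)]
    have := mul_le_mul_of_nonneg_left hwE_n (show (0 : ℝ) ≤ 16 * Λ by positivity)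
    linarith
  refine ⟨?_, ?_⟩
  · rw [hΨ, Complex.add_re, Complex.sub_re]
    have h1 := (abs_le.mp (Complex.abs_re_le_norm ((1 : ℂ) / u ^ 2))).1
    have h2 : C.re ≤ 2 * Λ := le_trans (le_trans (le_abs_self _) (Complex.abs_re_le_norm C)) hC
    linarith
  · rw [hΨ]
    calc ‖((-16 * Λ : ℝ) : ℂ) * (w * Complex.exp δ') - 1 / u ^ 2 + C‖
        ≤ ‖((-16 * Λ : ℝ) : ℂ) * (w * Complex.exp δ') - 1 / u ^ 2‖ + ‖C‖ := norm_add_le _ _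
      _ ≤ ‖((-16 * Λ : ℝ) : ℂ) * (w * Complex.exp δ')‖ + ‖(1 : ℂ) / u ^ 2‖ + ‖C‖ := by
          gcongr
          exact norm_sub_le _ _
      _ ≤ 16 * Λ * (25 / 16 * (53 / 50)) + 1 / 81 + 2 * Λ := by gcongr
      _ ≤ 32 * Λ := by linarith

end Summit.RiemannHypothesis.RiemannHypothesis.Theorems.JensenPolynomials.FarGumbel


end
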